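import Summits.QuantumFields.YangMills.Theorems.BalabanUVNodesN21AtSpineCarriersProfiled
import Literature.MathematicalPhysics.QuantumFieldTheory.Balaban1983to89.T4LipschitzLedger

/-!
# YM-DAG node N21 (= NE7c) AT THE SPINE CARRIERS ON THE PROFILED ROAD, MEASURE LEVEL: the K5 stub
# `YMDAG.UVSplit.S_N21 SRec` for every REALIZED (η)-reading — two represented runs `T4LipschitzLedger.TermRepr` on common
# per-term spaces, the two-run closeness (F∞) in a.e. form `SupClose … ρ` (node N16), `SiblingSuppression` of the realized
# shell-restricted siblings (NE7b species), and the carriers' shell parts PINNED as the realized ones `shellW` —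
# `T4LipschitzLedger.shellWeightBound_of_repr` BY NAME

Track A of `YM-PLAN.md` (cell `pub-ymgap`, HUMAN RULING D-0062 ∕ D-0088), node **N21**; seat `pub-ymgap-dag-n21-e` (R141 (C), strategy s3 =
ALTERNATIVE CURRENCY), generation 0, file 2 — the companion AT THE MEASURE LEVEL of file 1 `BalabanUVNodesN21AtSpineCarriersProfiled` (p453165;
ledger level), exactly as n21-a's 8″ `…N21AtSpineCarriersMeasure.s_N21_of_slotACReading` (END-I) is of its file 8 (road I's ledgers).  Kernel
bookkeeping BY NAME over landed modules: 0 `def`, 0 `sorry`, standard axioms.  COUNT-NEUTRAL; `--supports` the K3 item `SpineGivenEndpointR11`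
(stmt-QuantumFields-19676).

HONEST FRAMING.  NE7c (`T4IndicatorShell.ShellWeightBound`) is NOT PRINTED in [Bałaban 1983–89] and NOT PROVED here.  Design (η) (Lipschitz
cut-off profiles of fixed relative width in the live window, in both runs) is a NON-PRINTED PROCEDURE of the sibling cell `pub-balaban` (priced in
`T4LipschitzCutoff` §4–§7, never proved harmless).  This file says, on the OBJECTS rather than on ledgers, what a carrier predicate of record must
supply for N21 to follow on that road: per string and tuned run, (I1) the two runs' term weights REPRESENTED (`TermRepr`, pv07's convention for
[Balaban1988Convergent] (2.18) under (η): term `τ ∈ S.T K` at source `t` is `∫ (∏_{i<m} p_i)·R dμ_{K,τ}` on a measurable space `Ω K τ`, the `p_i`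
profile slot factors of either polarity with measurable tested variables of BOTH runs on that space, `R ≥ 0` integrable) — its instantiation on
Bałaban's terms is NODE O; (I2) (F∞) a.e.: `|u^A_i − u^B_i| ≤ ρ(K − a_i)·θ_i` (`SupClose`; node N16, NOT PRINTED — its per-configuration form from
n21-a files 3∕6∕7 `dev_close_of_n16` ∕ `abs_slotA_sub_slotB_le_of_n16` under `RegularSup` needs the dictionary «tested variable = cube-`sup` of the
minimiser's plaquette deviations over the configuration», NODE O); (I3) `SiblingSuppression` of the REALIZED shell-restricted siblings `sibW` (NE7b
species, node N20's lane; or structural by the flip involution `T4PatternLayer.siblingSuppression_layer₂`); and the PINNING of the bundle's shell parts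
as the realized ones, `S.shA = shellW … u^A u^B R^A`, `S.shB = shellW … u^B u^A R^B` (under (η) the shell parts ARE the integrated min-pieces — a
definition of the record, not an estimate), plus a summable record weight `S.Wsh` dominating the band weight.  NO anti-concentration, NO law of any
tested variable.  Nothing of Bałaban's is asserted; one finite four-torus programme at fixed `ε`; NOT continuum ∕ ℝ⁴ ∕ OS ∕ mass gap ∕ Clay.

CITATION HEADER (lean-in-tree rule 2026-08-18).  Everything BY NAME from the tree: `T4LipschitzLedger` §3–§5 (`TermRepr`, `SupClose`, `sibW`,
`shellW`, `shellWeightBound_of_repr`, `Sanity.*`), `T4LipschitzCutoff` (`SiblingSuppression`, `lipWeight`), file 1 of this seat, n21-a's file 1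
(`shellWeightBound_mono`) and file 8′ (`exists_family_and_datum`), file 3 §4 (`theta_lt_one`, `summable_width`).  Context only (SHAPE):
[Balaban1988Convergent] (2.18) p. 257 «ρ_k(V_k) = Σ χ_k(Ω_k)T_k({Ω_j},{Λ_j}) exp A_k» (a term = iterated positive integral of characteristic-function
factors × the remaining density).  No printed sentence is a hypothesis of any declaration.

WHAT IS PROVED ([folklore]).
§1 `n21_knit_repr` (explicit carriers: (I1)+(I2)+(I3) + the two pinning equations ⇒ `ShellWeightBound l₀ T A B shA shB Wsh` for any summable `Wsh`
  dominating `Σ_{a≤N} n_a·lipWeight Lχ S ρ a K`); `n21_knit_repr_n16Width` (width := N16's family `c₁θ^j`, `θ⁶ = L⁻¹`: sign ∕ summability by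
  file 3 §4).
§2 `s_N21_of_reprReading`, `s_N21_of_reprReading_n16Width` (`S_N21 SRec` for every realized (η)-reading predicate, ∃-closed over the spaces,
  measures and factor data in the idiom of n21-a's 8″).
§3 `s_N21_fires_on_reprReading` (vacuity guard A1–A6, pv07's §5 `Sanity` toy BY NAME: a realized reading predicate INHABITED at a non-degenerate
  bundle — nonempty classes, weights `1∕2` and `1∕2 − (1∕2)^K∕4 > 0`, run A's realized shell part `(1∕2)^K∕4 > 0`, record weight `(1∕2)^K > 0` — and
  `S_N21` fires on it by §2).
-/

set_option autoImplicit false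

noncomputable section

open scoped BigOperators
open MeasureTheory

namespace Summit.QuantumFields.YangMills.Theorems.N21AtSpineCarriersProfiledRealized

open Literature.MathematicalPhysics.QuantumFieldTheory.Balaban1983to89
open T4IndicatorShell (ShellWeightBound)
open T4LipschitzCutoff (SiblingSuppression lipWeight)
open T4LipschitzLedger (Pol TermRepr SupClose sibW shellW shellWeightBound_of_repr)
open YMDAG.UVSplit (SpineCarriers SpineRecordPred S_N21)
open N21ClosenessJunction (theta_lt_one summable_width)
open Finset

/-! ## §1 Explicit carriers: the realized (η) knit -/

section Explicit

variable {ι : Type*} {Ω : ℕ → ι → Type*} [∀ K τ, MeasurableSpace (Ω K τ)]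
  {l₀ : ℝ} {T : ℕ → Finset ι} {A B shA shB : ℕ → ℝ → ι → ℝ} {χ : ℕ → ℝ → ℝ} {κ Lχ : ℕ → ℝ} {N : ℕ} {n : ℕ → ℕ}
  {μ : (K : ℕ) → (τ : ι) → Measure (Ω K τ)} {m : ℕ → ι → ℕ} {slot : ℕ → ι → ℕ → Σ _ : ℕ, ℕ}
  {pol : ℕ → ι → ℕ → Pol} {θ : ℕ → ι → ℕ → ℝ} {uA uB : (K : ℕ) → (τ : ι) → ℕ → Ω K τ → ℝ}
  {RA RB : (K : ℕ) → ℝ → (τ : ι) → Ω K τ → ℝ} {ρ S : ℕ → ℝ}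

/-- **N21 KNIT, PROFILED ROAD, MEASURE LEVEL.**  At explicit carriers `(l₀, T, A, B, shA, shB)`: (I1) the two runs REPRESENTED on common per-term
spaces (`TermRepr`, tested variables in either order), (I2) (F∞) a.e. `SupClose … ρ` (node N16), (I3) `SiblingSuppression` of the realized siblings
in both runs with constants `S ≥ 0`, the width `ρ ≥ 0` SUMMABLE, and the shell parts PINNED as the realized ones (`shA = shellW … u^A u^B R^A`,
`shB = shellW … u^B u^A R^B`) ⇒ `ShellWeightBound l₀ T A B shA shB Wsh` for EVERY summable `Wsh` dominating the band weight
`Σ_{a≤N} n_a·lipWeight Lχ S ρ a K` (`T4LipschitzLedger.shellWeightBound_of_repr` + `shellWeightBound_mono` BY NAME).  NO anti-concentration.  CONDITIONAL on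
every displayed binder; NE7c NOT proved. [folklore] -/
theorem n21_knit_repr (hA : TermRepr l₀ T A χ κ Lχ N n μ m slot pol θ uA uB RA)
    (hB : TermRepr l₀ T B χ κ Lχ N n μ m slot pol θ uB uA RB) (hF : SupClose T μ m slot θ uA uB ρ)
    (hSA : SiblingSuppression l₀ T A N n (sibW χ κ μ m slot pol θ uA RA ρ) S)
    (hSB : SiblingSuppression l₀ T B N n (sibW χ κ μ m slot pol θ uB RB ρ) S)
    (hS : ∀ a ≤ N, 0 ≤ S a) (hρ0 : ∀ j, 0 ≤ ρ j) (hρ : Summable ρ)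
    (hshA : shA = shellW χ μ m slot pol θ uA uB RA) (hshB : shB = shellW χ μ m slot pol θ uB uA RB)
    {Wsh : ℕ → ℝ} (hWsh : ∀ K, ∑ a ∈ range (N + 1), (n a : ℝ) * lipWeight Lχ S ρ a K ≤ Wsh K) (hsum : Summable Wsh) :
    ShellWeightBound l₀ T A B shA shB Wsh := by
  subst hshA hshB
  exact shellWeightBound_mono (shellWeightBound_of_repr hA hB hF hSA hSB hS hρ0 hρ) hWsh hsum

/-- … at N16's width family `ρ_j = c₁·θ^j`, `θ⁶ = L⁻¹`, `2 ≤ L`, `0 < θ`, `0 ≤ c₁` (file 3 §4 `theta_lt_one` ∕ `summable_width` discharge the sign and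
summability clauses). [folklore] -/
theorem n21_knit_repr_n16Width {L : ℕ} {θr c₁ : ℝ} (hL2 : 2 ≤ L) (hθr : 0 < θr) (hθ6 : θr ^ 6 = ((L : ℝ))⁻¹) (hc₁ : 0 ≤ c₁)
    (hA : TermRepr l₀ T A χ κ Lχ N n μ m slot pol θ uA uB RA) (hB : TermRepr l₀ T B χ κ Lχ N n μ m slot pol θ uB uA RB)
    (hF : SupClose T μ m slot θ uA uB fun j => c₁ * θr ^ j)
    (hSA : SiblingSuppression l₀ T A N n (sibW χ κ μ m slot pol θ uA RA fun j => c₁ * θr ^ j) S)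
    (hSB : SiblingSuppression l₀ T B N n (sibW χ κ μ m slot pol θ uB RB fun j => c₁ * θr ^ j) S)
    (hS : ∀ a ≤ N, 0 ≤ S a)
    (hshA : shA = shellW χ μ m slot pol θ uA uB RA) (hshB : shB = shellW χ μ m slot pol θ uB uA RB)
    {Wsh : ℕ → ℝ} (hWsh : ∀ K, ∑ a ∈ range (N + 1), (n a : ℝ) * lipWeight Lχ S (fun j => c₁ * θr ^ j) a K ≤ Wsh K)
    (hsum : Summable Wsh) : ShellWeightBound l₀ T A B shA shB Wsh :=
  n21_knit_repr hA hB hF hSA hSB hS (fun j => mul_nonneg hc₁ (pow_nonneg hθr.le j)) (summable_width hL2 hθr hθ6 c₁) hshA hshB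
    hWsh hsum

end Explicit

/-! ## §2 At the spine carriers: `S_N21 SRec` for every realized profiled reading -/

section AtCarriers

variable {N : ℕ} [NeZero N]

/-- **`S_N21` FOR EVERY REALIZED (η) READING.**  If the carrier predicate `SRec` hands, with every bundle `S` it pins, per-term measurable spaces
`Ω K τ` with measures `μ K τ`, profiles `χ` (widths `κ`, Lipschitz constants `Lχ`), a window `Nw` with counts `n`, factor data `(m, slot, pol, θ)`,
the two runs' tested variables `u^A, u^B` and remainders `R^A, R^B`, a width `ρ` and sibling constants `Ssup`, such that (I1) both runs are
REPRESENTED at `(S.l₀, S.T, S.A)` ∕ `(S.l₀, S.T, S.B)`, (I2) `SupClose … ρ`, (I3) `SiblingSuppression` of the realized siblings in both runs,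
`0 ≤ Ssup`, `0 ≤ ρ` summable, the shell parts PINNED `S.shA = shellW … u^A u^B R^A`, `S.shB = shellW … u^B u^A R^B`, and `S.Wsh` summable dominating
the band weight — then `S_N21 SRec` (§1). [folklore] -/
theorem s_N21_of_reprReading (SRec : SpineRecordPred N)
    (hread : ∀ (F : T4Continuum.T4Family) (D : YMDAG.UVSplit.Datum F N) (g₀ : ℕ → ℝ)
      (os : List (T4Continuum.ULoop F)) (S : SpineCarriers), SRec F D g₀ os S →
      ∃ (Ω : ℕ → S.ι → Type) (_mΩ : ∀ K τ, MeasurableSpace (Ω K τ)) (μ : (K : ℕ) → (τ : S.ι) → Measure (Ω K τ))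
        (χ : ℕ → ℝ → ℝ) (κ Lχ : ℕ → ℝ) (Nw : ℕ) (n : ℕ → ℕ) (m : ℕ → S.ι → ℕ) (slot : ℕ → S.ι → ℕ → Σ _ : ℕ, ℕ)
        (pol : ℕ → S.ι → ℕ → Pol) (θ : ℕ → S.ι → ℕ → ℝ) (uA uB : (K : ℕ) → (τ : S.ι) → ℕ → Ω K τ → ℝ)
        (RA RB : (K : ℕ) → ℝ → (τ : S.ι) → Ω K τ → ℝ) (ρ Ssup : ℕ → ℝ),
        TermRepr S.l₀ S.T S.A χ κ Lχ Nw n μ m slot pol θ uA uB RA ∧ TermRepr S.l₀ S.T S.B χ κ Lχ Nw n μ m slot pol θ uB uA RB ∧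
        SupClose S.T μ m slot θ uA uB ρ ∧
        SiblingSuppression S.l₀ S.T S.A Nw n (sibW χ κ μ m slot pol θ uA RA ρ) Ssup ∧
        SiblingSuppression S.l₀ S.T S.B Nw n (sibW χ κ μ m slot pol θ uB RB ρ) Ssup ∧
        (∀ a ≤ Nw, 0 ≤ Ssup a) ∧ (∀ j, 0 ≤ ρ j) ∧ Summable ρ ∧
        S.shA = shellW χ μ m slot pol θ uA uB RA ∧ S.shB = shellW χ μ m slot pol θ uB uA RB ∧
        (∀ K, ∑ a ∈ range (Nw + 1), (n a : ℝ) * lipWeight Lχ Ssup ρ a K ≤ S.Wsh K) ∧ Summable S.Wsh) :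
    S_N21 SRec := by
  intro F D g₀ os S hS
  obtain ⟨Ω, mΩ, μ, χ, κ, Lχ, Nw, n, m, slot, pol, θ, uA, uB, RA, RB, ρ, Ssup, hA, hB, hF, hSA, hSB, hS0, hρ0, hρ, hshA, hshB,
    hWsh, hsum⟩ := hread F D g₀ os S hS
  exact n21_knit_repr hA hB hF hSA hSB hS0 hρ0 hρ hshA hshB hWsh hsum

/-- **`S_N21` FOR EVERY REALIZED (η) READING AT N16's WIDTH** `ρ_j = c₁·θ^j`, `θ⁶ = L⁻¹` (`2 ≤ L`, `0 < θ`, `0 ≤ c₁` in place of `0 ≤ ρ`,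
`Summable ρ`; file 3 §4 BY NAME). [folklore] -/
theorem s_N21_of_reprReading_n16Width (SRec : SpineRecordPred N)
    (hread : ∀ (F : T4Continuum.T4Family) (D : YMDAG.UVSplit.Datum F N) (g₀ : ℕ → ℝ)
      (os : List (T4Continuum.ULoop F)) (S : SpineCarriers), SRec F D g₀ os S →
      ∃ (Ω : ℕ → S.ι → Type) (_mΩ : ∀ K τ, MeasurableSpace (Ω K τ)) (μ : (K : ℕ) → (τ : S.ι) → Measure (Ω K τ))
        (χ : ℕ → ℝ → ℝ) (κ Lχ : ℕ → ℝ) (Nw : ℕ) (n : ℕ → ℕ) (m : ℕ → S.ι → ℕ) (slot : ℕ → S.ι → ℕ → Σ _ : ℕ, ℕ)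
        (pol : ℕ → S.ι → ℕ → Pol) (θ : ℕ → S.ι → ℕ → ℝ) (uA uB : (K : ℕ) → (τ : S.ι) → ℕ → Ω K τ → ℝ)
        (RA RB : (K : ℕ) → ℝ → (τ : S.ι) → Ω K τ → ℝ) (Ssup : ℕ → ℝ) (L : ℕ) (θr c₁ : ℝ),
        2 ≤ L ∧ 0 < θr ∧ θr ^ 6 = ((L : ℝ))⁻¹ ∧ 0 ≤ c₁ ∧
        TermRepr S.l₀ S.T S.A χ κ Lχ Nw n μ m slot pol θ uA uB RA ∧ TermRepr S.l₀ S.T S.B χ κ Lχ Nw n μ m slot pol θ uB uA RB ∧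
        SupClose S.T μ m slot θ uA uB (fun j => c₁ * θr ^ j) ∧
        SiblingSuppression S.l₀ S.T S.A Nw n (sibW χ κ μ m slot pol θ uA RA fun j => c₁ * θr ^ j) Ssup ∧
        SiblingSuppression S.l₀ S.T S.B Nw n (sibW χ κ μ m slot pol θ uB RB fun j => c₁ * θr ^ j) Ssup ∧
        (∀ a ≤ Nw, 0 ≤ Ssup a) ∧
        S.shA = shellW χ μ m slot pol θ uA uB RA ∧ S.shB = shellW χ μ m slot pol θ uB uA RB ∧
        (∀ K, ∑ a ∈ range (Nw + 1), (n a : ℝ) * lipWeight Lχ Ssup (fun j => c₁ * θr ^ j) a K ≤ S.Wsh K) ∧ Summable S.Wsh) :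
    S_N21 SRec := by
  intro F D g₀ os S hS
  obtain ⟨Ω, mΩ, μ, χ, κ, Lχ, Nw, n, m, slot, pol, θ, uA, uB, RA, RB, Ssup, L, θr, c₁, hL2, hθr, hθ6, hc₁, hA, hB, hF, hSA, hSB,
    hS0, hshA, hshB, hWsh, hsum⟩ := hread F D g₀ os S hS
  exact n21_knit_repr_n16Width hL2 hθr hθ6 hc₁ hA hB hF hSA hSB hS0 hshA hshB hWsh hsum

end AtCarriers

/-! ## §3 Vacuity guard: the realized profiled reading is INHABITED non-degenerately and `S_N21` FIRES on it -/

section NonVacuity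

open T4LipschitzLedger.Sanity

/-- **THE REALIZED (η) READING IS INHABITED AND `S_N21` FIRES ON IT.**  There is a carrier predicate `SRec` over `SU(2)` data such that (i) `SRec` is
a REALIZED profiled reading predicate — every bundle it pins carries EXACTLY the package of §2's `s_N21_of_reprReading`; (ii) it is INHABITED: some
family, datum, bare sequence, string and bundle satisfy it (pv07's §5 toy `T4LipschitzLedger.Sanity`: one term per cutoff, a point space with the
Dirac mass, one small-field profile factor of age `0` with the piecewise-linear profile of width `1∕2`, run A testing `3∕4`, run B `3∕4 + (1∕2)^K∕8`,
remainder `1`; `termRepr_A∕_B`, `supClose` with the summable width `(1∕2)^j∕8`, `siblingSuppression_A∕_B` with `S ≡ 4`), the bundle having nonempty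
classes, positive weights `1∕2`, `1∕2 − (1∕2)^K∕4` in the two runs, run A's realized shell part `(1∕2)^K∕4 > 0`, nonnegative run-B shell part, and
positive record weight `S.Wsh K = (1∕2)^K`; (iii) `S_N21 SRec` holds (by §2).  A toy, NOT Bałaban's terms. [folklore] -/
theorem s_N21_fires_on_reprReading :
    ∃ SRec : SpineRecordPred 2,
      (∀ (F : T4Continuum.T4Family) (D : YMDAG.UVSplit.Datum F 2) (g₀ : ℕ → ℝ) (os : List (T4Continuum.ULoop F))
          (S : SpineCarriers), SRec F D g₀ os S →
        ∃ (Ω : ℕ → S.ι → Type) (_mΩ : ∀ K τ, MeasurableSpace (Ω K τ)) (μ : (K : ℕ) → (τ : S.ι) → Measure (Ω K τ))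
          (χ : ℕ → ℝ → ℝ) (κ Lχ : ℕ → ℝ) (Nw : ℕ) (n : ℕ → ℕ) (m : ℕ → S.ι → ℕ) (slot : ℕ → S.ι → ℕ → Σ _ : ℕ, ℕ)
          (pol : ℕ → S.ι → ℕ → Pol) (θ : ℕ → S.ι → ℕ → ℝ) (uA uB : (K : ℕ) → (τ : S.ι) → ℕ → Ω K τ → ℝ)
          (RA RB : (K : ℕ) → ℝ → (τ : S.ι) → Ω K τ → ℝ) (ρ Ssup : ℕ → ℝ),
          TermRepr S.l₀ S.T S.A χ κ Lχ Nw n μ m slot pol θ uA uB RA ∧ TermRepr S.l₀ S.T S.B χ κ Lχ Nw n μ m slot pol θ uB uA RB ∧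
          SupClose S.T μ m slot θ uA uB ρ ∧
          SiblingSuppression S.l₀ S.T S.A Nw n (sibW χ κ μ m slot pol θ uA RA ρ) Ssup ∧
          SiblingSuppression S.l₀ S.T S.B Nw n (sibW χ κ μ m slot pol θ uB RB ρ) Ssup ∧
          (∀ a ≤ Nw, 0 ≤ Ssup a) ∧ (∀ j, 0 ≤ ρ j) ∧ Summable ρ ∧
          S.shA = shellW χ μ m slot pol θ uA uB RA ∧ S.shB = shellW χ μ m slot pol θ uB uA RB ∧
          (∀ K, ∑ a ∈ range (Nw + 1), (n a : ℝ) * lipWeight Lχ Ssup ρ a K ≤ S.Wsh K) ∧ Summable S.Wsh) ∧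
      (∃ (F : T4Continuum.T4Family) (D : YMDAG.UVSplit.Datum F 2) (g₀ : ℕ → ℝ) (os : List (T4Continuum.ULoop F))
          (S : SpineCarriers), SRec F D g₀ os S ∧ (∀ K, (S.T K).Nonempty) ∧
          (∀ K t τ, 0 < S.A K t τ ∧ 0 < S.B K t τ ∧ 0 < S.shA K t τ ∧ 0 ≤ S.shB K t τ) ∧ ∀ K, 0 < S.Wsh K) ∧
      S_N21 SRec := by
  obtain ⟨F, ⟨Dat⟩⟩ := N21AtSpineCarriers.exists_family_and_datum
  have hsumW : Summable fun K : ℕ => (1 / 2 : ℝ) ^ K := summable_geometric_of_lt_one (by norm_num) (by norm_num)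
  refine ⟨_, fun _ _ _ _ _ h => h, ?_, s_N21_of_reprReading _ fun _ _ _ _ _ h => h⟩
  refine ⟨F, Dat, fun _ => 0, [],
    { ι := Unit, l₀ := 1, vol := 1, K₀ := 0, T := T, A := A, B := B,
      shA := shellW χ μ m slot pol θ uA uB R, shB := shellW χ μ m slot pol θ uB uA R, Bad := fun _ _ => ∅,
      W := fun _ => 0, Wsh := fun K => (1 / 2 : ℝ) ^ K, δ := fun _ => 0 }, ?_, ?_, ?_, ?_⟩
  · exact ⟨Ω, inferInstance, μ, χ, κ, Lχ, 0, n, m, slot, pol, θ, uA, uB, R, R, ρ, S, termRepr_A, termRepr_B, supClose,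
      siblingSuppression_A, siblingSuppression_B, fun _ _ => by norm_num [S], fun j => by change (0 : ℝ) ≤ (1 / 2 : ℝ) ^ j / 8; positivity, summable_ρ,
      rfl, rfl, fun K => (bandWeight K).le, hsumW⟩
  · intro K; exact ⟨(), by simp [T]⟩
  · intro K t τ
    obtain ⟨⟩ := τ
    -- the toy remainder `R ≡ 1` ignores the source, so the realized shell parts are source-independent (`rfl`)
    have e : shellW χ μ m slot pol θ uB uA R K t () = shellW χ μ m slot pol θ uB uA R K 0 () := rfl
    refine ⟨by norm_num [A], ?_, shellW_A_pos K t, ?_⟩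
    · have h1 := half_pow_le_one K
      simp only [B]
      linarith
    · show 0 ≤ shellW χ μ m slot pol θ uB uA R K t ()
      rw [e]
      exact termRepr_B.shellW_nonneg K 0 (by simp) () (by simp [T])
  · intro K; exact half_pow_pos K

end NonVacuity

end Summit.QuantumFields.YangMills.Theorems.N21AtSpineCarriersProfiledRealized

end
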